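import Mathlib
import HarnessLib.Audit
import Summits.PneNP.PneNP.Theorems.PstarGapLemma

/-!
# The single-query rung of the gap lemma, and the gap lemma without expansion (ROUND-24, items T24.12 / T24.8f)

FRONTIER range-avoidance ladder, rung F-N3, ROUND 24 (cell `pnp-ideate`, planner seat p3; restricted-model proof complexity —
nothing here bears on `P` versus `NP`).

`PstarGapLemma.PstarGapLemmaSO` (the live crux of the parity-decision-tree depth route) bounds every minimal `W`-infeasible output set
`J` of an expanding typed pure-`P⋆` instance with simple overlaps and variable degree `≤ Δ` by `K(Δ)·|W|`.  This file records two
statements around it.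

* `PstarGapOne` — the FIRST RUNG (T24.12, OPEN): the case `|W| ≤ 1` (one parity query), `|J| ≤ K(Δ)`.  It follows from the crux
  (`pstarGapOne_of_gapSO`) and is the weakest statement in which the interaction of the AND layer with FREE CLOSINGS is visible:
  eliminating the XOR variables turns `W`-feasibility of `J` into solvability, in the AND variables, of the constraint space
  `Cyc_y(H[J]) ⊕ Paid` (memo ROUND-24-PRESEED §13 R8), where every cycle `C` of the XOR graph `H[J]` (output `j` = edge between its two
  XOR slots) contributes the cost-free quadratic constraint `Σ_{j∈C} a_{p_j} a_{q_j} = Σ_{j∈C} y_j`.  With one paid parity the question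
  is whether these free constraints can force a parity; the planner's sketch (memo §13 R9) settles the structure of a minimal `J` for a
  pure AND-parity (no private XOR variable; at least half the outputs doubly private; every almost-solution holds all other doubly
  private outputs at `(1,1)`) but not yet the bound.
* `GapLemmaSOWithoutExpansion` — the crux WITHOUT `BoundaryExpanding` (T24.8f, expected FALSE — negative edge): the gadget `𝔊` of nine
  outputs whose AND graph is `K_{3,3}` on `{p₁,p₂,p₃} × {q₁,q₂,q₃}` and whose XOR graph is the Hamiltonian nine-cycle
  `(11)(22)(33)(12)(23)(31)(13)(21)(32)` (XOR-adjacent outputs are AND-disjoint, so simple overlaps; typed; degree `3`) has the single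
  free closing `(a_{p₁}+a_{p₂}+a_{p₃})·(a_{q₁}+a_{q₂}+a_{q₃}) = γ`; for `γ = 1` it forces both parities at no cost, and `N` disjoint
  copies with the ONE paid parity `Σ_i (a_{p₁⁽ⁱ⁾}+a_{p₂⁽ⁱ⁾}+a_{p₃⁽ⁱ⁾}) = N+1` make all `9N` outputs minimal infeasible with `|W| = 1`
  (deleting an output opens its copy's cycle).  `bdry 𝔊 = ∅`, so `BoundaryExpanding` excludes it: any proof of the crux must spend
  expansion on the cyclic part of `H[J]` (peeling, `PstarGapPeeling`, spends it at `W = ∅` only).  `gapLemmaSO_of_without` records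
  that the expansion-free statement is the stronger one, so its refutation leaves the crux intact.
-/

set_option linter.dupNamespace false

open Finset Literature.Computability.Complexity
open Summit.PneNP.PneNP.Theorems.PstarTyped (Typed)
open Summit.PneNP.PneNP.Theorems.PstarSALevel (BoundaryExpanding SimpleOverlap)
open Summit.PneNP.PneNP.Theorems.PstarGapLemma (MinInfeasible GapBound MaxDegree PstarGapLemmaSO)

namespace Summit.PneNP.PneNP.Theorems.PstarGapOne

/-- **T24.12 — the single-query rung (OPEN).**  On expanding typed pure-`P⋆` instances with simple overlaps and variable degree `≤ Δ`,
a minimal infeasible output set under at most ONE parity constraint has size at most `K(Δ)`.  FRONTIER. -/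
@[conjecture] def PstarGapOne : Prop :=
  ∀ Δ : ℕ, ∃ K : ℕ, ∀ (n m r : ℕ) (I : LocalMap 4 n m), I.IsPure xorAndPred → Typed I → BoundaryExpanding r I →
    SimpleOverlap I → MaxDegree Δ I → ∀ (y : Fin m → Bool) (W : Finset (Finset (Fin n) × Bool)) (J : Finset (Fin m)),
      W.card ≤ 1 → J.card ≤ r → MinInfeasible I y W J → J.card ≤ K

/-- **T24.8f — the crux without boundary expansion (expected FALSE; negative edge).**  See the module docstring for the `K_{3,3}` /
nine-cycle gadget that should refute it at `Δ = 3`.  FRONTIER. -/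
@[conjecture] def GapLemmaSOWithoutExpansion : Prop :=
  ∀ Δ : ℕ, ∃ K : ℕ, 0 < K ∧ ∀ (n m r : ℕ) (I : LocalMap 4 n m), I.IsPure xorAndPred → Typed I →
    SimpleOverlap I → MaxDegree Δ I → ∀ y : Fin m → Bool, GapBound K r I y

/-- The single-query rung follows from the crux. -/
theorem pstarGapOne_of_gapSO (h : PstarGapLemmaSO) : PstarGapOne := by
  intro Δ
  obtain ⟨K, _, hK⟩ := h Δ
  refine ⟨K, fun n m r I hI hT hB hS hD y W J hW hJ hmin => ?_⟩
  have h1 : J.card ≤ K * W.card := hK n m r I hI hT hB hS hD y W J hJ hmin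
  calc J.card ≤ K * W.card := h1
    _ ≤ K * 1 := Nat.mul_le_mul_left K hW
    _ = K := Nat.mul_one K

/-- The expansion-free statement is the stronger one (so refuting it, T24.8f, leaves the crux intact). -/
theorem gapLemmaSO_of_without (h : GapLemmaSOWithoutExpansion) : PstarGapLemmaSO := by
  intro Δ
  obtain ⟨K, hK0, hK⟩ := h Δ
  exact ⟨K, hK0, fun n m r I hI hT _ hS hD y => hK n m r I hI hT hS hD y⟩

end Summit.PneNP.PneNP.Theorems.PstarGapOne
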